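import Literature.Computability.Cryptography.RegevSamplerEtaCosBound
import Literature.Computability.Cryptography.RegevSamplerWindows
import HarnessLib

/-!
# Regev 2009, Lemma 3.14 in machine form: the cosine-table error from the grid-scale window

Topic `Literature/Computability/Cryptography`, grouping namespace `Regev2009.SamplerRegs`; sequel of
`RegevSamplerEtaCosBound.lean` (`etaCos_schedule_le : etaCos ≤ ℓ·6·2⁻¹^m + 2·(c·(2·2^ℓ+1))`) and
`RegevSamplerWindows.lean` (`hηc_of`, `c_le_one_of`). The second term of the schedule bound is small only when
`D_t² ≫ 2^ℓ`; this file states the window WITH A SLACK EXPONENT `s`: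

* `hηc_pow_of` — `2^j ≤ D_t` and `ℓ + 4 + s ≤ 2j` give `2π/D_t²·(2·2^ℓ + 1) ≤ 2·2⁻¹^s` (`s = 0` is `hηc_of`);
* `etaCos_window_le` — with `s = m + 2`: `etaCos ℓ (2m+1) (4(2m+ℓ+3)) (8/4^(2m+ℓ+3)) (2π/D_t²) ≤ (6ℓ+1)·2⁻¹^m`,
  the form `η ≤ m^c·2⁻¹^m` that `exists_negligible_slack_le` wants.

Everything here is proved; no named fact is introduced.

## References

* O. Regev, *On lattices, learning with errors, random linear codes, and cryptography*, J. ACM 56 (2009),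
  art. 34, Lemma 3.14 (proof), Lemma 3.12 (proof) [Regev2009].
-/

noncomputable section

namespace Literature.Computability.Cryptography

namespace Regev2009

namespace SamplerRegs

open scoped Real

/-- **`hηc` with a slack exponent**: `2^j ≤ D_t` and `ℓ + 4 + s ≤ 2j` give `2π/D_t²·(2·2^ℓ+1) ≤ 2·2⁻¹^s`.
[cite: Regev2009, Lemma 3.12 (proof)] -/
theorem hηc_pow_of {D : ℝ} {j ℓ s : ℕ} (hD : (2 : ℝ) ^ j ≤ D) (hj : ℓ + 4 + s ≤ 2 * j) :
    2 * π / D ^ 2 * (2 * 2 ^ ℓ + 1) ≤ 2 * (2⁻¹ : ℝ) ^ s := by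
  have hD0 : 0 < D := lt_of_lt_of_le (by positivity) hD
  have hD2 : (2 : ℝ) ^ (ℓ + 4 + s) ≤ D ^ 2 :=
    (pow_le_pow_right₀ one_le_two hj).trans (by rw [pow_mul']; exact pow_le_pow_left₀ (by positivity) hD 2)
  have key : (2 : ℝ) ^ ℓ * 2 ^ 4 ≤ D ^ 2 * (2⁻¹ : ℝ) ^ s := by
    rw [inv_pow, ← div_eq_mul_inv, le_div_iff₀ (by positivity), ← pow_add, ← pow_add]
    exact hD2
  rw [div_mul_eq_mul_div, div_le_iff₀ (by positivity)]
  have h1 : (1 : ℝ) ≤ 2 ^ ℓ := one_le_pow₀ one_le_two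
  nlinarith [Real.pi_lt_d2, Real.pi_pos]

/-- **The cosine-table error from the window**: for `c = 2π/D_t²`, `2^j ≤ D_t` and `ℓ + 4 + (m+2) ≤ 2j`,
`etaCos ℓ (2m+1) (4(2m+ℓ+3)) (8/4^(2m+ℓ+3)) c ≤ (6ℓ + 1)·2⁻¹^m`. [cite: Regev2009, Lemma 3.14 (proof), Lemma 3.12 (proof)] -/
theorem etaCos_window_le {D c : ℝ} {j ℓ m : ℕ} (hc : c = 2 * π / D ^ 2) (hD : (2 : ℝ) ^ j ≤ D)
    (hj : ℓ + 4 + (m + 2) ≤ 2 * j) :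
    etaCos ℓ (2 * m + 1) (4 * (2 * m + ℓ + 3)) (8 / 4 ^ (2 * m + ℓ + 3)) c ≤ (6 * ℓ + 1) * (2⁻¹ : ℝ) ^ m := by
  have hc1 : c ≤ 1 := by rw [hc]; exact c_le_one_of hD (by omega)
  have hη : c * (2 * 2 ^ ℓ + 1) ≤ 2 * (2⁻¹ : ℝ) ^ (m + 2) := by rw [hc]; exact hηc_pow_of hD hj
  have h4 : 2 * (2⁻¹ : ℝ) ^ (m + 2) = (2⁻¹ : ℝ) ^ m / 2 := by rw [pow_add]; ring
  rw [h4] at hη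
  calc etaCos ℓ (2 * m + 1) (4 * (2 * m + ℓ + 3)) (8 / 4 ^ (2 * m + ℓ + 3)) c
      ≤ ℓ * (6 * (2⁻¹ : ℝ) ^ m) + 2 * (c * (2 * 2 ^ ℓ + 1)) := etaCos_schedule_le ℓ m hc1
    _ ≤ ℓ * (6 * (2⁻¹ : ℝ) ^ m) + 2 * ((2⁻¹ : ℝ) ^ m / 2) := by linarith
    _ = (6 * ℓ + 1) * (2⁻¹ : ℝ) ^ m := by ring

/-- `(6ℓ+1)·2⁻¹^m ≤ m^c·2⁻¹^m` once `6ℓ + 1 ≤ m^c` — the hypothesis `η ≤ m^c 2⁻¹^m` of the slack envelope. [folklore] -/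
theorem etaCos_bound_le_pow {ℓ m c : ℕ} (h : 6 * ℓ + 1 ≤ m ^ c) :
    (6 * ℓ + 1 : ℝ) * (2⁻¹ : ℝ) ^ m ≤ (m : ℝ) ^ c * (2⁻¹ : ℝ) ^ m :=
  mul_le_mul_of_nonneg_right (by exact_mod_cast h) (by positivity)

end SamplerRegs

end Regev2009

end Literature.Computability.Cryptography

end
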